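import Mathlib.Data.Matrix.ColumnRowPartitioned
import Mathlib.Data.Matrix.Block
import Literature.Algebra.EuclideanLattices.KhotTensorBoost
import HarnessLib

/-!
# Khot 2005, §§3–5: the basic reduction CVP → SVP (Theorem 5.1) — the lattices and the deterministic cores

Topic `Algebra/EuclideanLattices`, namespace `Literature.Algebra.EuclideanLattices.Khot`. Third
brick (after `KhotSVPHardness.lean` and `KhotTensorBoost.lean`) of the decomposition of the
named fact `Literature.Algebra.EuclideanLattices.gapSVP_const_isNPHardRandomized` (pqc.S17)
through `Literature.Algebra.EuclideanLattices.Khot2005_SAT_randReducible_gapSVP`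
(Khot, J. ACM 52 (2005), Thm. 1.1 = SAT →(Thm. 3.1) CVP →(Thm. 5.1) SVP →(§§6–7) GapSVP).
This file vendors, for the Euclidean norm `p = 2` and in exact integer arithmetic, the explicit
integer matrices of §§3–5 and PROVES everything about them that does not involve counting or
probability:

* §3 (Thm. 3.1, due to Arora–Babai–Stern–Sweedyk 1997): the CVP instance `(B_cvp, t)` of a set
  system (`cvpBasis`, `cvpTarget`), property (3) from an exact cover
  (`cvpBasis_indicator_sub_target`) and property (4) from "no `< d` sets cover the universe"
  (`cvpBasis_no`). Its complexity-theoretic input (gap exact set cover is NP-hard for every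
  constant factor; Bellare–Goldwasser–Lund–Russell 1993) is the named fact
  `Literature.Computability.Complexity.AroraEtAl1997_prop6` (`GapSetCover.lean`).
* §4: the BCH lattice `B_BCH = [[Q·P, 2Q·I],[I, 0]]` (`bchBasis`) and the shift `s` (`bchShift`)
  for an abstract `{0,1}`-matrix `P` with `d`-wise `GF(2)`-independent columns (`DWise`; that the
  BCH parity-check matrix has this property with `h = (d/2) log N`, Thm. 4.1, is a later brick);
  **Lemma 4.2** (`bch_lemma_4_2`) and the deterministic part of **Lemma 4.3** (`bch_good_vector`:
  the coefficient vectors `z_J` with `B_BCH z_J - s = 0 ∘ 1_J` and small norm).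
* §5.1: the intermediate lattice `B_int` (`intBasis`, `intCoeff`, `intBasis_mulVec`,
  injectivity `intBasis_mulVec_eq_zero`), the good vectors of **Lemma 5.4** (`intBasis_good`,
  `intSqNorm_intCoeff`), annoying vectors (Def. 5.3, `Annoying`) and the structural part of
  **Lemma 5.5** (`intBasis_annoying`: annoying ⇒ `j₀ = 0` and all coordinates even).
* §5.2.2: the final lattice `B' = [[B, 0],[D·rB, D·q]]` (`finBasis`, `finBasis_mulVec`) and the
  deterministic cores of **Lemma 5.6** (`noStructure_finBasis`: if `r` kills every annoying
  vector then `B'` has the NO-structure `Khot.NoStructure` consumed by Lemma 7.2) and of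
  **Lemma 5.7** (`yes_finBasis`: a good vector surviving the random constraint yields the YES
  data consumed by Lemma 7.1 / `Khot.short_vector_of_yes`).

## The source, as printed (J. ACM 52 (2005) 789–808), and the rendering

* Thm. 3.1 / Fig. 1 (p. 796): "`B_cvp` is `Q`-multiple of the element-set incidence matrix
  appended by an identity matrix. The vector `t` has first `n'` co-ordinates equal to `Q` and the
  rest are `0`"; (3) "`B_cvp y - t` … has exactly `ηd` co-ordinates equal to `1`"; (4) "for any
  … `y` and any nonzero integer `j₀`, the vector `B_cvp y - j₀t` either has one co-ordinate equal
  to [a nonzero multiple of] `d^{4d}`, or has at least `d` nonzero co-ordinates".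
* §4 / Fig. 2 (p. 797) and Lemma 4.2 (p. 798), Lemma 4.3 (p. 798).
* §5.1 / Fig. 3 (p. 800): "`B_int x = B_int(y ∘ z ∘ j₀) = 2(B_cvp y + j₀t) ∘ (B_BCH z + j₀s)`";
  Def. 5.2–5.3, Lemmas 5.4–5.5 (pp. 800–801).
* §5.2.2 / Fig. 4 and Lemmas 5.6–5.8 (pp. 802–803): "`Bx' = B_int x ∘ d^{20k}(rB_int x + l₀q)`".

Rendering. (i) Index types are arbitrary finite types: universe `U`, sets `S` (the set system
is `F : S → Finset U`), parity rows `H`, code positions `Nn`; coefficient vectors of `B_int` are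
indexed by `(S ⊕ (Nn ⊕ H)) ⊕ Unit` (`y`, `z`, `y'`, `j₀`) and its rows by `(U ⊕ S) ⊕ (H ⊕ Nn)`.
(ii) `p = 2`; the parameters `Q` (printed `d^{4d}`), `D` (printed `d^{20k}`), `d`, `q` are
abstract with the printed order relations as hypotheses (`D ≤ Q`, `0 < q`). (iii) The modulus
`q` need not be prime in these deterministic cores (primality is used only in the probability
estimates of Lemmas 5.6–5.8). (iv) Thm. 3.1 (4) is used in the `+ j₀t` form of §5 (equivalent,
`j₀` ranges over all nonzero integers). (v) The norm bound of Lemma 4.3 is recorded as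
`‖z_J‖² ≤ |J| + h|J|²` (printed `r + h(r/2)ᵖ`; any polynomial bound serves §5).

## What is NOT here (remaining bricks; plan in the tenure NOTES.md)

The counting bounds `#G` (Lemma 4.3 / 5.4: `≥ (1/100)·C(N,r)/2ʰ` good vectors) and `#A`
(Lemma 5.5), the probability estimates (Lemma 4.3's sampling of `s`, Lemma 5.6's union bound,
Lemma 5.8 = Chebyshev, §5.2.1's prime), Thm. 4.1 (BCH codes), the `ℓ₂` padding to a square
nonsingular basis and the threshold, and the machine-level assembly.

## References

* S. Khot, *Hardness of approximating the shortest vector problem in lattices*, J. ACM 52 (2005)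
  789–808: Thm. 3.1, §4 (Thm. 4.1, Lemmas 4.2–4.3), §5 (Thm. 5.1, Def. 5.2–5.3, Lemmas 5.4–5.8).
* S. Arora, L. Babai, J. Stern, Z. Sweedyk, J. Comput. Syst. Sci. 54 (1997) 317–331, Prop. 6 and
  the proof of Thm. 5 (the CVP instance).
-/

namespace Literature.Algebra.EuclideanLattices

open Matrix Finset

/-! ### Hamming weight of concatenations -/

section Hamming

variable {ι κ : Type} [Fintype ι] [Fintype κ]

/-- The number of nonzero coordinates of a concatenation `f ∘ g` is additive. [folklore] -/
theorem hammingNorm_sum_elim (f : ι → ℤ) (g : κ → ℤ) :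
    hammingNorm (Sum.elim f g) = hammingNorm f + hammingNorm g := by
  classical
  unfold hammingNorm
  rw [← Finset.card_disjSum]
  congr 1
  ext x
  rcases x with x | x <;> simp [Finset.mem_disjSum]

/-- Appending zero coordinates does not change the number of nonzero coordinates. [folklore] -/
theorem hammingNorm_sum_elim_zero (f : ι → ℤ) :
    hammingNorm (Sum.elim f (0 : κ → ℤ)) = hammingNorm f := by
  rw [hammingNorm_sum_elim, hammingNorm_zero, add_zero]

/-- `hammingNorm (c • v) = hammingNorm v` for `c ≠ 0` (no zero divisors in `ℤ`). [folklore] -/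
theorem hammingNorm_smul_int {c : ℤ} (hc : c ≠ 0) (v : ι → ℤ) :
    hammingNorm (c • v) = hammingNorm v := by
  classical
  unfold hammingNorm
  congr 1
  ext i
  simp [hc]

end Hamming

namespace Khot

/-! ### §3: the CVP instance of Theorem 3.1 (Arora–Babai–Stern–Sweedyk) -/

section CVP

variable {U S : Type} [Fintype U] [Fintype S] [DecidableEq U] [DecidableEq S]

/-- The element–set incidence matrix of a set system `F = (S_j)_{j ∈ S}` over the universe `U`:
entry `(e, j)` is `1` if `e ∈ S_j` and `0` otherwise (Khot 2005, proof of Thm. 3.1 / Fig. 1).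
[cite: Khot2005, Thm. 3.1 (proof, Fig. 1)] -/
def incidence (F : S → Finset U) : Matrix U S ℤ :=
  Matrix.of fun e j => if e ∈ F j then 1 else 0

/-- The indicator vector `1_T ∈ {0,1}^S` of a finite set of indices. [folklore] -/
def indicator (T : Finset S) : S → ℤ := fun j => if j ∈ T then 1 else 0

/-- **The CVP basis of Thm. 3.1** (Khot 2005, Fig. 1; due to Arora–Babai–Stern–Sweedyk 1997):
`B_cvp = [Q · (element–set incidence matrix) ; I]`, an `(n' + n'') × n''` integer matrix
("`B_cvp` is `Q`-multiple of the element-set incidence matrix appended by an identity matrix").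
[cite: Khot2005, Thm. 3.1 (proof, Fig. 1)] -/
def cvpBasis (Q : ℤ) (F : S → Finset U) : Matrix (U ⊕ S) S ℤ :=
  Matrix.fromRows (Q • incidence F) 1

/-- **The CVP target of Thm. 3.1**: "the vector `t` has first `n'` co-ordinates equal to `Q`
and the rest are `0`" (Khot 2005, Fig. 1). [cite: Khot2005, Thm. 3.1 (proof, Fig. 1)] -/
def cvpTarget (Q : ℤ) : U ⊕ S → ℤ :=
  Sum.elim (fun _ => Q) 0

omit [Fintype U] [DecidableEq S] in
/-- Row `e` of the incidence matrix applied to `y`: `∑_{j : e ∈ S_j} y_j`.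
[cite: Khot2005, Thm. 3.1 (proof)] -/
theorem incidence_mulVec (F : S → Finset U) (y : S → ℤ) (e : U) :
    (incidence F *ᵥ y) e = ∑ j ∈ univ.filter (fun j => e ∈ F j), y j := by
  simp only [Matrix.mulVec, dotProduct, incidence, Matrix.of_apply, ite_mul, one_mul, zero_mul]
  rw [Finset.sum_filter]

omit [Fintype U] in
/-- `B_cvp y = (Q · incidence · y) ∘ y`. [cite: Khot2005, Thm. 3.1 (proof)] -/
theorem cvpBasis_mulVec (Q : ℤ) (F : S → Finset U) (y : S → ℤ) :
    cvpBasis Q F *ᵥ y = Sum.elim (Q • (incidence F *ᵥ y)) y := by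
  rw [cvpBasis, Matrix.fromRows_mulVec, Matrix.smul_mulVec, Matrix.one_mulVec]

omit [Fintype U] in
/-- **Thm. 3.1 (3) (YES).** If `T` is an exact cover — every element of the universe lies in
exactly one `S_j`, `j ∈ T` — then for `y = 1_T ∈ {0,1}^S` the vector `B_cvp y - t` is the
`{0,1}`-vector `0 ∘ 1_T` with exactly `|T|` coordinates equal to `1` ("`B_cvp y - t` has
exactly `ηd` co-ordinates equal to `1` and the rest are zero"). [cite: Khot2005, Thm. 3.1 (3)] -/
theorem cvpBasis_indicator_sub_target (Q : ℤ) (F : S → Finset U) (T : Finset S)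
    (hT : ∀ e : U, (T.filter fun j => e ∈ F j).card = 1) :
    cvpBasis Q F *ᵥ indicator T - cvpTarget Q = Sum.elim (0 : U → ℤ) (indicator T) := by
  rw [cvpBasis_mulVec]
  funext i
  rcases i with e | j
  · simp only [Pi.sub_apply, Sum.elim_inl, cvpTarget, Pi.smul_apply, smul_eq_mul, Pi.zero_apply]
    rw [incidence_mulVec]
    have : ∑ j ∈ univ.filter (fun j => e ∈ F j), indicator T j =
        ((T.filter fun j => e ∈ F j).card : ℤ) := by
      simp only [indicator, Finset.sum_boole, Finset.filter_filter]
      congr 2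
      ext j
      simp [and_comm]
    rw [this, hT e]
    simp
  · simp [cvpTarget, indicator]

/-- **Thm. 3.1 (4) (NO).** If no fewer than `d` of the sets cover the universe ("there is no
set-cover of size `d`": every sub-family of `< d` sets misses an element), then for every
coefficient vector `y` and every integer `j₀ ≠ 0` the vector `B_cvp y + j₀ t` either has a
coordinate of magnitude at least `Q` (a nonzero multiple of `Q`, at an uncovered element) or
has at least `d` nonzero coordinates. (Printed with `- j₀ t`; `j₀` ranges over all nonzero
integers, so the two forms agree; §5 uses `+ j₀ t`.) [cite: Khot2005, Thm. 3.1 (4)] -/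
theorem cvpBasis_no {Q : ℤ} (hQ : 0 ≤ Q) (F : S → Finset U) {d : ℕ}
    (hNO : ∀ T : Finset S, T.card < d → ∃ e : U, ∀ j ∈ T, e ∉ F j) (y : S → ℤ) {j₀ : ℤ}
    (hj₀ : j₀ ≠ 0) :
    (∃ i, Q ≤ |(cvpBasis Q F *ᵥ y + j₀ • cvpTarget Q : U ⊕ S → ℤ) i|) ∨
      d ≤ hammingNorm (cvpBasis Q F *ᵥ y + j₀ • cvpTarget Q : U ⊕ S → ℤ) := by
  classical
  rw [cvpBasis_mulVec]
  by_cases hd : d ≤ hammingNorm y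
  · refine Or.inr (hd.trans ?_)
    -- the `S`-block of the vector is `y` itself
    have : cvpTarget (U := U) (S := S) Q = Sum.elim (fun _ => Q) 0 := rfl
    rw [this, show j₀ • (Sum.elim (fun _ : U => Q) (0 : S → ℤ)) = Sum.elim (fun _ => j₀ * Q) 0 from by
      funext i; rcases i with i | i <;> simp]
    rw [show Sum.elim (Q • (incidence F *ᵥ y)) y + Sum.elim (fun _ : U => j₀ * Q) (0 : S → ℤ) =
        Sum.elim (Q • (incidence F *ᵥ y) + fun _ => j₀ * Q) y from by
      funext i; rcases i with i | i <;> simp]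
    rw [hammingNorm_sum_elim]
    exact Nat.le_add_left _ _
  · push Not at hd
    obtain ⟨e, he⟩ := hNO (univ.filter fun j => y j ≠ 0) hd
    refine Or.inl ⟨Sum.inl e, ?_⟩
    have h0 : (incidence F *ᵥ y) e = 0 := by
      rw [incidence_mulVec]
      refine Finset.sum_eq_zero fun j hj => ?_
      by_contra hy
      exact he j (Finset.mem_filter.2 ⟨Finset.mem_univ _, hy⟩) (Finset.mem_filter.1 hj).2
    simp only [Pi.add_apply, Sum.elim_inl, Pi.smul_apply, smul_eq_mul, h0, mul_zero, zero_add,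
      cvpTarget]
    rw [abs_mul, abs_of_nonneg hQ]
    exact le_mul_of_one_le_left hQ (Int.one_le_abs hj₀)

end CVP

/-! ### §4: the BCH lattice (Lemma 4.2) and its good coefficient vectors (Lemma 4.3) -/

section BCH

variable {H Nn : Type} [Fintype H] [Fintype Nn] [DecidableEq H] [DecidableEq Nn]

/-- **`d`-wise independence over `GF(2)`** of the columns of a `{0,1}`-matrix `P` (the property
of the BCH parity-check matrix of Thm. 4.1: "any `d` columns of the matrix are linearly
independent over `GF(2)`"), in integer terms: whenever a coefficient vector `z` has at least one
and at most `d` odd entries, `P z` has an odd coordinate (a set of `≤ d` columns is independent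
over `GF(2)` iff no nonempty sub-family sums to `0 (mod 2)`, and `(Pz)_r ≡ ∑_{i : zᵢ odd} P_{ri}
(mod 2)`). [cite: Khot2005, Thm. 4.1] -/
def DWise (P : Matrix H Nn ℤ) (d : ℕ) : Prop :=
  ∀ z : Nn → ℤ, (∃ i, Odd (z i)) → (univ.filter fun i => Odd (z i)).card ≤ d →
    ∃ r, Odd ((P *ᵥ z) r)

/-- **The BCH lattice** (Khot 2005, §4, Fig. 2): `B_BCH = [[Q·P_BCH, 2Q·I],[I, 0]]`, an
`(h + N) × (N + h)` integer matrix — "the upper right block is a `2Q`-multiple of the `h × h`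
identity matrix. The lower left block is the `N × N` identity matrix. The lower right block is
zero." Coefficient vectors are `z ∘ y` with `z ∈ ℤᴺ`, `y ∈ ℤʰ`. [cite: Khot2005, §4 (Fig. 2)] -/
def bchBasis (Q : ℤ) (P : Matrix H Nn ℤ) : Matrix (H ⊕ Nn) (Nn ⊕ H) ℤ :=
  Matrix.fromBlocks (Q • P) ((2 * Q) • (1 : Matrix H H ℤ)) 1 0

/-- **The shift vector `s`** of the BCH lattice (Khot 2005, §4 and Lemma 4.3): "the desired
vector `s` [is] obtained by appending `N` zero co-ordinates to the vector `Qs'`", `s' ∈ {0,1}ʰ`.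
[cite: Khot2005, Lemma 4.3 (proof)] -/
def bchShift (Q : ℤ) (s' : H → ℤ) : H ⊕ Nn → ℤ :=
  Sum.elim (Q • s') 0

/-- `B_BCH (z ∘ y) = Q(Pz + 2y) ∘ z`. [cite: Khot2005, §4 (Fig. 2)] -/
theorem bchBasis_mulVec (Q : ℤ) (P : Matrix H Nn ℤ) (z : Nn → ℤ) (y : H → ℤ) :
    bchBasis Q P *ᵥ Sum.elim z y = Sum.elim (Q • (P *ᵥ z + (2 : ℤ) • y)) z := by
  rw [bchBasis, Matrix.fromBlocks_mulVec]
  simp only [Sum.elim_comp_inl, Sum.elim_comp_inr, Matrix.smul_mulVec, Matrix.one_mulVec,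
    Matrix.zero_mulVec, add_zero, smul_add]
  congr 1
  funext r
  simp only [Pi.add_apply, Pi.smul_apply, smul_eq_mul]
  ring

/-- The coefficient vector is recovered from the lower block: `B_BCH (z ∘ y) = 0` forces `z = 0`
and then `2Q y = 0`; for `Q ≠ 0` the columns of `B_BCH` are independent. [cite: Khot2005, §4] -/
theorem bchBasis_mulVec_eq_zero {Q : ℤ} (hQ : Q ≠ 0) (P : Matrix H Nn ℤ) (z : Nn → ℤ) (y : H → ℤ)
    (h : bchBasis Q P *ᵥ Sum.elim z y = 0) : z = 0 ∧ y = 0 := by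
  rw [bchBasis_mulVec] at h
  have hz : z = 0 := funext fun i => congrFun h (Sum.inr i)
  refine ⟨hz, funext fun r => ?_⟩
  have h1 : (Q • (P *ᵥ z + (2 : ℤ) • y)) r = 0 := congrFun h (Sum.inl r)
  rw [hz, Matrix.mulVec_zero, zero_add, Pi.smul_apply, Pi.smul_apply, smul_eq_mul,
    smul_eq_mul] at h1
  rcases mul_eq_zero.1 h1 with h2 | h2
  · exact absurd h2 hQ
  · simpa using h2

/-- **Khot 2005, Lemma 4.2.** If the columns of `P` are `d`-wise independent over `GF(2)` and
`Q ≥ 0`, every nonzero vector of the BCH lattice "has either one coordinate with magnitude at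
least `Q = d^{4d}`, or has at least `d` nonzero co-ordinates, or has all co-ordinates even."
Proof as printed: `z = 0` gives a nonzero multiple of `2Q` on top; all `zᵢ` even gives an even
vector; `1 ≤ #{odd zᵢ} ≤ d` gives an odd, hence nonzero, multiple of `Q` on top by `d`-wise
independence; `≥ d + 1` odd `zᵢ` are that many nonzero lower coordinates.
[cite: Khot2005, Lemma 4.2] -/
theorem bch_lemma_4_2 {Q : ℤ} (hQ : 0 ≤ Q) {P : Matrix H Nn ℤ} {d : ℕ} (hP : DWise P d)
    (z : Nn → ℤ) (y : H → ℤ) (hzy : Sum.elim z y ≠ 0) :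
    (∃ i, Q ≤ |(bchBasis Q P *ᵥ Sum.elim z y) i|) ∨ d ≤ hammingNorm (bchBasis Q P *ᵥ Sum.elim z y) ∨
      ∀ i, Even ((bchBasis Q P *ᵥ Sum.elim z y) i) := by
  classical
  rw [bchBasis_mulVec]
  by_cases hz : z = 0
  · -- `z = 0`: some `y_r ≠ 0`, and the top coordinate `2Q y_r` has magnitude `≥ Q`
    subst hz
    have hy : y ≠ 0 := fun hy => hzy (by subst hy; funext i; rcases i with i | i <;> rfl)
    obtain ⟨r, hr⟩ := Function.ne_iff.1 hy
    refine Or.inl ⟨Sum.inl r, ?_⟩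
    simp only [Sum.elim_inl, Pi.smul_apply, Matrix.mulVec_zero, zero_add, smul_eq_mul]
    rw [abs_mul, abs_mul, abs_of_nonneg hQ, abs_two]
    have := Int.one_le_abs hr
    nlinarith
  by_cases hodd : ∃ i, Odd (z i)
  · by_cases hcard : (univ.filter fun i => Odd (z i)).card ≤ d
    · -- few odd entries: an odd coordinate of `Pz`, hence of `Pz + 2y`, times `Q`
      obtain ⟨r, hr⟩ := hP z hodd hcard
      refine Or.inl ⟨Sum.inl r, ?_⟩
      simp only [Sum.elim_inl, Pi.smul_apply, Pi.add_apply, smul_eq_mul]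
      have hodd' : Odd ((P *ᵥ z) r + 2 * y r) := by
        rcases hr with ⟨t, ht⟩
        exact ⟨t + y r, by rw [ht]; ring⟩
      have hne : (P *ᵥ z) r + 2 * y r ≠ 0 := fun h0 => by
        rw [h0] at hodd'
        exact (Int.not_even_iff_odd.2 hodd') ⟨0, rfl⟩
      rw [abs_mul, abs_of_nonneg hQ]
      exact le_mul_of_one_le_right hQ (Int.one_le_abs hne)
    · -- many odd entries: that many nonzero lower coordinates
      push Not at hcard
      refine Or.inr (Or.inl ?_)
      rw [hammingNorm_sum_elim]
      refine le_trans ?_ (Nat.le_add_left _ _)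
      refine hcard.le.trans (Finset.card_le_card fun i hi => ?_)
      have hi' : Odd (z i) := (Finset.mem_filter.1 hi).2
      refine Finset.mem_filter.2 ⟨Finset.mem_univ _, fun h0 => ?_⟩
      rw [h0] at hi'
      exact (Int.not_even_iff_odd.2 hi') ⟨0, rfl⟩
  · -- all entries of `z` even: the whole vector is even
    push Not at hodd
    refine Or.inr (Or.inr fun i => ?_)
    have heven : ∀ i, Even (z i) := fun i => Int.not_odd_iff_even.1 (hodd i)
    rcases i with r | i
    · simp only [Sum.elim_inl, Pi.smul_apply, Pi.add_apply, smul_eq_mul]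
      refine (Even.add ?_ ⟨y r, by ring⟩).mul_left Q
      simp only [Matrix.mulVec, dotProduct]
      exact Finset.even_sum _ fun i _ => (heven i).mul_left _
    · exact heven i

/-- **The good coefficient vectors of the BCH lattice (Lemma 4.3, the deterministic part).**
For a set `J` of columns whose `GF(2)`-sum is `s'` — i.e. `(P 1_J)_r ≡ s'_r (mod 2)` for all
`r` — and `{0,1}`-data `P`, `s'`, the coefficient vector `z_J = 1_J ∘ y`,
`y_r = (s'_r - (P 1_J)_r)/2`, satisfies `B_BCH z_J - s = 0 ∘ 1_J` ("`B_BCH z_J - s` is a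
`{0,1}`-vector with exactly `r` co-ordinates equal to `1`", namely on `J`) and
`‖z_J‖² ≤ |J| + h·|J|²` (printed: `‖z_J‖ₚᵖ ≤ r + h (r/2)ᵖ`). The probabilistic part of
Lemma 4.3 (a random `s'` has `≥ (1/100) C(N,r)/2ʰ` such `J`) is not in this file.
[cite: Khot2005, Lemma 4.3 (proof)] -/
theorem bch_good_vector {Q : ℤ} {P : Matrix H Nn ℤ} (hP01 : ∀ r i, P r i = 0 ∨ P r i = 1)
    {s' : H → ℤ} (hs01 : ∀ r, s' r = 0 ∨ s' r = 1) (J : Finset Nn)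
    (hJ : ∀ r, Even ((P *ᵥ indicator J) r - s' r)) :
    bchBasis Q P *ᵥ Sum.elim (indicator J) (fun r => (s' r - (P *ᵥ indicator J) r) / 2) -
        bchShift Q s' = Sum.elim (0 : H → ℤ) (indicator J) ∧
      intSqNorm (Sum.elim (indicator J) (fun r => (s' r - (P *ᵥ indicator J) r) / 2)) ≤
        J.card + Fintype.card H * (J.card : ℤ) ^ 2 := by
  have hdiv : ∀ r, (2 : ℤ) ∣ s' r - (P *ᵥ indicator J) r := fun r => by
    have := hJ r
    rw [even_iff_two_dvd] at this
    rwa [← dvd_neg, neg_sub] at this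
  constructor
  · rw [bchBasis_mulVec]
    funext i
    rcases i with r | i
    · simp only [Pi.sub_apply, Sum.elim_inl, Pi.smul_apply, Pi.add_apply, smul_eq_mul, bchShift,
        Pi.zero_apply]
      rw [Int.mul_ediv_cancel' (hdiv r)]
      ring
    · simp [bchShift]
  · -- norm bound: `1_J` contributes `|J|`, each `y_r` has `|y_r| ≤ |J|`
    rw [intSqNorm_sum_elim]
    have h1 : intSqNorm (indicator J) = J.card := by
      unfold intSqNorm indicator
      simp only [ite_pow, one_pow, zero_pow (two_ne_zero), Finset.sum_boole]
      congr 1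
      simp
    have hPJ : ∀ r, 0 ≤ (P *ᵥ indicator J) r ∧ (P *ᵥ indicator J) r ≤ J.card := by
      intro r
      simp only [Matrix.mulVec, dotProduct, indicator, mul_ite, mul_one, mul_zero, Finset.sum_ite_mem,
        Finset.univ_inter]
      constructor
      · exact Finset.sum_nonneg fun i _ => by rcases hP01 r i with h | h <;> simp [h]
      · calc ∑ i ∈ J, P r i ≤ ∑ _i ∈ J, (1 : ℤ) :=
              Finset.sum_le_sum fun i _ => by rcases hP01 r i with h | h <;> simp [h]
          _ = J.card := by simp
    have hy : ∀ r, ((s' r - (P *ᵥ indicator J) r) / 2) ^ 2 ≤ (J.card : ℤ) ^ 2 := by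
      intro r
      obtain ⟨h0, hle⟩ := hPJ r
      have habs : |(s' r - (P *ᵥ indicator J) r) / 2| ≤ J.card := by
        rw [abs_le]
        rcases hs01 r with h | h <;> rw [h] <;> constructor <;> omega
      calc ((s' r - (P *ᵥ indicator J) r) / 2) ^ 2 = |(s' r - (P *ᵥ indicator J) r) / 2| ^ 2 :=
            (sq_abs _).symm
        _ ≤ (J.card : ℤ) ^ 2 := pow_le_pow_left₀ (abs_nonneg _) habs 2
    rw [h1]
    gcongr
    calc intSqNorm (fun r => (s' r - (P *ᵥ indicator J) r) / 2)
        = ∑ r, ((s' r - (P *ᵥ indicator J) r) / 2) ^ 2 := rfl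
      _ ≤ ∑ _r : H, (J.card : ℤ) ^ 2 := Finset.sum_le_sum fun r _ => hy r
      _ = Fintype.card H * (J.card : ℤ) ^ 2 := by simp

end BCH

/-! ### §5.1: the intermediate lattice; good and annoying vectors (Lemmas 5.4, 5.5) -/

section Annoying

variable {ι : Type} [Fintype ι]

/-- **Annoying vectors** (Khot 2005, Def. 5.3, for `p = 2`): a nonzero integer vector that
FAILS Condition (3) of Thm. 5.1 — "all its co-ordinates are bounded by `d^{20k}` [here: of
magnitude `< D`] and number of nonzero co-ordinates is fewer than `d` and either there is an
odd co-ordinate or all co-ordinates are even and at most `d/2ᵖ` of them are nonzero" — i.e.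
the negation of the three alternatives of `NoStructure`. [cite: Khot2005, Def. 5.3] -/
def Annoying (v : ι → ℤ) (d D : ℕ) : Prop :=
  v ≠ 0 ∧ (∀ i, |v i| < D) ∧ hammingNorm v < d ∧ ¬((∀ i, Even (v i)) ∧ d ≤ 4 * hammingNorm v)

/-- A nonzero vector that is not annoying satisfies one of the three alternatives of
Thm. 5.1 (3) (by definition). [cite: Khot2005, Def. 5.3] -/
theorem alternatives_of_not_annoying {v : ι → ℤ} {d D : ℕ} (hv : v ≠ 0) (h : ¬Annoying v d D) :
    (∃ i, (D : ℤ) ≤ |v i|) ∨ d ≤ hammingNorm v ∨ ((∀ i, Even (v i)) ∧ d ≤ 4 * hammingNorm v) := by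
  unfold Annoying at h
  push Not at h
  rcases le_or_gt d (hammingNorm v) with hd | hd
  · exact Or.inr (Or.inl hd)
  by_cases hbig : ∃ i, (D : ℤ) ≤ |v i|
  · exact Or.inl hbig
  push Not at hbig
  exact Or.inr (Or.inr (h hv hbig hd))

end Annoying

section Intermediate

variable {U S H Nn : Type} [Fintype U] [Fintype S] [Fintype H] [Fintype Nn]
variable [DecidableEq U] [DecidableEq S] [DecidableEq H] [DecidableEq Nn]

/-- **The intermediate lattice** (Khot 2005, §5.1, Fig. 3): for coefficient vectors
`x = y ∘ z ∘ j₀` (here `(y ∘ (z ∘ y')) ∘ j₀`, `j₀` indexed by `Unit`),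
`B_int x = 2(B_cvp y + j₀ t) ∘ (B_BCH (z ∘ y') + j₀ s)`: the block-diagonal matrix
`[[2B_cvp, 0],[0, B_BCH]]` with the extra column `2t ∘ s`. (One large integer `Q` serves both
`B_cvp` and `B_BCH`, as printed: `Q = d^{4d}`.) [cite: Khot2005, §5.1 (Fig. 3)] -/
def intBasis (Q : ℤ) (F : S → Finset U) (P : Matrix H Nn ℤ) (s' : H → ℤ) :
    Matrix ((U ⊕ S) ⊕ (H ⊕ Nn)) ((S ⊕ (Nn ⊕ H)) ⊕ Unit) ℤ :=
  Matrix.fromCols (Matrix.fromBlocks ((2 : ℤ) • cvpBasis Q F) 0 0 (bchBasis Q P))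
    (Matrix.of fun i _ => Sum.elim ((2 : ℤ) • cvpTarget Q) (bchShift Q s') i)

/-- The coefficient vector `x = y ∘ z ∘ j₀` of the intermediate lattice, from its parts
`y ∈ ℤ^S` (CVP part), `z ∘ y'` (BCH part) and `j₀ ∈ ℤ`. [cite: Khot2005, §5.1] -/
def intCoeff (y : S → ℤ) (z : Nn → ℤ) (y' : H → ℤ) (j₀ : ℤ) : (S ⊕ (Nn ⊕ H)) ⊕ Unit → ℤ :=
  Sum.elim (Sum.elim y (Sum.elim z y')) fun _ => j₀

omit [Fintype U] [Fintype S] [Fintype H] [Fintype Nn] [DecidableEq U] [DecidableEq S] [DecidableEq H]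
  [DecidableEq Nn] in
/-- Every coefficient vector of the intermediate lattice is `intCoeff y z y' j₀` for its parts.
[cite: Khot2005, §5.1] -/
theorem intCoeff_parts (x : (S ⊕ (Nn ⊕ H)) ⊕ Unit → ℤ) :
    x = intCoeff (fun j => x (Sum.inl (Sum.inl j))) (fun i => x (Sum.inl (Sum.inr (Sum.inl i))))
      (fun r => x (Sum.inl (Sum.inr (Sum.inr r)))) (x (Sum.inr ())) := by
  funext i
  rcases i with ((j | (i | r))) | ⟨⟩ <;> rfl

omit [Fintype U] in
/-- `B_int (y ∘ z ∘ j₀) = 2(B_cvp y + j₀ t) ∘ (B_BCH (z ∘ y') + j₀ s)` (Khot 2005, §5.1, the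
displayed formula). [cite: Khot2005, §5.1] -/
theorem intBasis_mulVec (Q : ℤ) (F : S → Finset U) (P : Matrix H Nn ℤ) (s' : H → ℤ)
    (y : S → ℤ) (z : Nn → ℤ) (y' : H → ℤ) (j₀ : ℤ) :
    intBasis Q F P s' *ᵥ intCoeff y z y' j₀ =
      Sum.elim ((2 : ℤ) • (cvpBasis Q F *ᵥ y + j₀ • cvpTarget Q))
        (bchBasis Q P *ᵥ Sum.elim z y' + j₀ • bchShift Q s') := by
  rw [intBasis, intCoeff, Matrix.fromCols_mulVec, Matrix.fromBlocks_mulVec]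
  simp only [Sum.elim_comp_inl, Sum.elim_comp_inr, Matrix.zero_mulVec, add_zero, zero_add,
    Matrix.smul_mulVec]
  have hcol : (Matrix.of fun i (_ : Unit) => Sum.elim ((2 : ℤ) • cvpTarget Q) (bchShift Q s') i) *ᵥ
      (fun _ => j₀) = j₀ • Sum.elim ((2 : ℤ) • cvpTarget (U := U) (S := S) Q) (bchShift (Nn := Nn) Q s') := by
    funext i
    simp [Matrix.mulVec, dotProduct, mul_comm]
  rw [hcol]
  funext i
  rcases i with i | i
  · simp only [Pi.add_apply, Sum.elim_inl, Pi.smul_apply, smul_eq_mul]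
    ring
  · simp only [Pi.add_apply, Sum.elim_inr, Pi.smul_apply]

omit [Fintype U] in
/-- The columns of `B_int` are independent when the universe is nonempty and `Q ≠ 0`:
`B_int x = 0` forces `y = 0` (identity block), then `j₀ = 0` (a universe coordinate `2Qj₀`),
then `z = 0`, `y' = 0` (`bchBasis_mulVec_eq_zero`). (Thm. 3.1 (1): "`t` … is linearly
independent of the columns of matrix `B_cvp`".) [cite: Khot2005, Thm. 3.1 (1) and §5.1] -/
theorem intBasis_mulVec_eq_zero [Nonempty U] {Q : ℤ} (hQ : Q ≠ 0) (F : S → Finset U)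
    (P : Matrix H Nn ℤ) (s' : H → ℤ) (x : (S ⊕ (Nn ⊕ H)) ⊕ Unit → ℤ)
    (h : intBasis Q F P s' *ᵥ x = 0) : x = 0 := by
  rw [intCoeff_parts x, intBasis_mulVec] at h
  set y : S → ℤ := fun j => x (Sum.inl (Sum.inl j))
  set z : Nn → ℤ := fun i => x (Sum.inl (Sum.inr (Sum.inl i)))
  set y' : H → ℤ := fun r => x (Sum.inl (Sum.inr (Sum.inr r)))
  set j₀ : ℤ := x (Sum.inr ())
  have hcvp : cvpBasis Q F *ᵥ y + j₀ • cvpTarget Q = 0 := by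
    have h1 := congrArg (fun f => f ∘ Sum.inl) h
    simp only [Sum.elim_comp_inl] at h1
    funext i
    have := congrFun h1 i
    simpa using this
  rw [cvpBasis_mulVec] at hcvp
  have hy : y = 0 := funext fun j => by simpa [cvpTarget] using congrFun hcvp (Sum.inr j)
  have hj₀ : j₀ = 0 := by
    obtain ⟨e⟩ := ‹Nonempty U›
    have := congrFun hcvp (Sum.inl e)
    simp only [Pi.add_apply, Sum.elim_inl, Pi.smul_apply, smul_eq_mul, hy, Matrix.mulVec_zero,
      Pi.zero_apply, mul_zero, zero_add, cvpTarget, mul_eq_zero, hQ, or_false] at this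
    exact this
  have hbch : bchBasis Q P *ᵥ Sum.elim z y' = 0 := by
    have h2 := congrArg (fun f => f ∘ Sum.inr) h
    simp only [Sum.elim_comp_inr, hj₀, zero_smul, add_zero] at h2
    exact h2
  obtain ⟨hz, hy'⟩ := bchBasis_mulVec_eq_zero hQ P z y' hbch
  rw [intCoeff_parts x]
  show intCoeff y z y' j₀ = 0
  rw [hy, hz, hy', hj₀]
  funext i
  rcases i with ((j | (i | r))) | ⟨⟩ <;> rfl

/-- **Lemma 5.4 (the good vectors, deterministic part).** If `yc` solves the CVP instance as in
Thm. 3.1 (3) (`B_cvp yc - t = 0 ∘ 1_T`) and `z_J ∘ y_J` is a good BCH coefficient vector as in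
Lemma 4.3 (`B_BCH z_J - s = 0 ∘ 1_J`), then `x = yc ∘ z_J ∘ (-1)` gives
`B_int x = 2(B_cvp yc - t) ∘ (B_BCH z_J - s) = (0 ∘ 2·1_T) ∘ (0 ∘ 1_J)`: a `{0,1,2}`-vector with
`|T|` twos and `|J|` ones, so `‖B_int x‖² = 4|T| + |J|` (printed: `‖B_int x‖ₚᵖ ≤ 2ᵖηd + r = γd`)
— "clearly, its all co-ordinates are `{0,1,2}` and exactly `r` of them are equal to `1`".
[cite: Khot2005, Lemma 5.4 (proof)] -/
theorem intBasis_good (Q : ℤ) (F : S → Finset U) (P : Matrix H Nn ℤ) (s' : H → ℤ)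
    {yc : S → ℤ} {T : Finset S} (hyc : cvpBasis Q F *ᵥ yc - cvpTarget Q = Sum.elim (0 : U → ℤ) (indicator T))
    {z : Nn → ℤ} {y' : H → ℤ} {J : Finset Nn}
    (hz : bchBasis Q P *ᵥ Sum.elim z y' - bchShift Q s' = Sum.elim (0 : H → ℤ) (indicator J)) :
    intBasis Q F P s' *ᵥ intCoeff yc z y' (-1) =
        Sum.elim (Sum.elim (0 : U → ℤ) ((2 : ℤ) • indicator T)) (Sum.elim (0 : H → ℤ) (indicator J)) ∧
      intSqNorm (intBasis Q F P s' *ᵥ intCoeff yc z y' (-1)) = 4 * T.card + J.card := by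
  have hv : intBasis Q F P s' *ᵥ intCoeff yc z y' (-1) =
      Sum.elim (Sum.elim (0 : U → ℤ) ((2 : ℤ) • indicator T)) (Sum.elim (0 : H → ℤ) (indicator J)) := by
    rw [intBasis_mulVec, neg_one_smul, neg_one_smul, ← sub_eq_add_neg, ← sub_eq_add_neg, hyc, hz]
    congr 1
    funext i
    rcases i with i | i <;> simp
  refine ⟨hv, ?_⟩
  rw [hv, intSqNorm_sum_elim, intSqNorm_sum_elim, intSqNorm_sum_elim, intSqNorm_smul]
  have hind : ∀ {κ : Type} [Fintype κ] [DecidableEq κ] (T : Finset κ), intSqNorm (indicator T) = T.card := by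
    intro κ _ _ T
    unfold intSqNorm indicator
    simp only [ite_pow, one_pow, zero_pow (two_ne_zero), Finset.sum_boole]
    congr 1
    simp
  rw [hind, hind]
  simp [intSqNorm]

omit [Fintype U] [DecidableEq U] [DecidableEq S] [DecidableEq H] [DecidableEq Nn] in
/-- The good vectors have small coefficient vectors: `‖yc ∘ z ∘ (-1)‖² = ‖yc‖² + ‖z ∘ y'‖² + 1`
(printed: "`‖x‖ₚᵖ ≤ ‖yc‖ₚᵖ + ‖z‖ₚᵖ + 1`"). [cite: Khot2005, Lemma 5.4 (proof)] -/
theorem intSqNorm_intCoeff (y : S → ℤ) (z : Nn → ℤ) (y' : H → ℤ) (j₀ : ℤ) :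
    intSqNorm (intCoeff y z y' j₀) = intSqNorm y + intSqNorm (Sum.elim z y') + j₀ ^ 2 := by
  rw [intCoeff, intSqNorm_sum_elim, intSqNorm_sum_elim]
  simp [intSqNorm]

/-- **Lemma 5.5 (structure of the annoying vectors).** In the NO case of the CVP instance
(no `< d` sets cover the universe), with `d`-wise independent `P` and `0 ≤ Q`, `D ≤ Q`: an
annoying vector `B_int x`, `x = y ∘ z ∘ j₀`, has `j₀ = 0` ("Otherwise, by Condition (4) of
Theorem 3.1, the vector `B_cvp y + j₀t` either has one co-ordinate equal to `d^{4d} > d^{20k}`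
or has at least `d` nonzero co-ordinates. In either case, `B_int x` will not be an annoying
vector") and all its coordinates are even ("combine Lemma 4.2 and the assumption that `B_int x`
is annoying. This implies that all the co-ordinates of `B_BCH z` are even"). The counting of
such vectors (`#A`) is not in this file. [cite: Khot2005, Lemma 5.5 (proof)] -/
theorem intBasis_annoying {Q : ℤ} (hQ : 0 ≤ Q) (F : S → Finset U) {P : Matrix H Nn ℤ} {d D : ℕ}
    (hNO : ∀ T : Finset S, T.card < d → ∃ e : U, ∀ j ∈ T, e ∉ F j) (hP : DWise P d)
    (hDQ : (D : ℤ) ≤ Q) (s' : H → ℤ) (y : S → ℤ) (z : Nn → ℤ) (y' : H → ℤ) (j₀ : ℤ)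
    (hA : Annoying (intBasis Q F P s' *ᵥ intCoeff y z y' j₀) d D) :
    j₀ = 0 ∧ ∀ i, Even ((intBasis Q F P s' *ᵥ intCoeff y z y' j₀) i) := by
  obtain ⟨hne, hsmall, hfew, -⟩ := hA
  rw [intBasis_mulVec] at hne hsmall hfew ⊢
  -- `j₀ = 0`
  have hj₀ : j₀ = 0 := by
    by_contra hj₀
    rcases cvpBasis_no hQ F hNO y hj₀ with ⟨i, hi⟩ | hd
    · have := hsmall (Sum.inl i)
      simp only [Sum.elim_inl, Pi.smul_apply, smul_eq_mul, abs_mul, abs_two] at this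
      have h0 : 0 ≤ |(cvpBasis Q F *ᵥ y + j₀ • cvpTarget Q : U ⊕ S → ℤ) i| := abs_nonneg _
      linarith
    · refine absurd hfew (not_lt.2 (hd.trans ?_))
      rw [hammingNorm_sum_elim, hammingNorm_smul_int two_ne_zero]
      exact Nat.le_add_right _ _
  subst hj₀
  refine ⟨rfl, ?_⟩
  simp only [zero_smul, add_zero] at hne hsmall hfew ⊢
  -- the BCH block is even by Lemma 4.2 (the other alternatives contradict annoyance)
  have hbch : ∀ i, Even ((bchBasis Q P *ᵥ Sum.elim z y') i) := by
    by_cases hzy : Sum.elim z y' = 0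
    · intro i
      rw [hzy, Matrix.mulVec_zero]
      exact ⟨0, rfl⟩
    rcases bch_lemma_4_2 hQ hP z y' hzy with ⟨i, hi⟩ | hd | heven
    · have := hsmall (Sum.inr i)
      simp only [Sum.elim_inr] at this
      linarith
    · refine absurd hfew (not_lt.2 (hd.trans ?_))
      rw [hammingNorm_sum_elim]
      exact Nat.le_add_left _ _
    · exact heven
  intro i
  rcases i with i | i
  · simp only [Sum.elim_inl, Pi.smul_apply, smul_eq_mul]
    exact even_two_mul _
  · exact hbch i

end Intermediate

/-! ### §5.2.2: the final lattice (random sub-lattice) and the cores of Lemmas 5.6, 5.7 -/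

section Final

variable {R C : Type} [Fintype R] [Fintype C]

/-- **The final lattice of Thm. 5.1** (Khot 2005, §5.2.2, Fig. 4): from a basis `B` (there:
`B_int`), a row vector `r` (random modulo `q`), the modulus `q` and the large integer `D`
(printed `d^{20k}`): `B' = [[B, 0],[D·rB, D·q]]`, "one more column and one more row than the
matrix `B_int`"; coefficient vectors `x' = x ∘ l₀` and `B'x' = B x ∘ D(rBx + l₀q)`.
[cite: Khot2005, §5.2.2 (Fig. 4)] -/
def finBasis (B : Matrix R C ℤ) (r : R → ℤ) (D q : ℤ) : Matrix (R ⊕ Unit) (C ⊕ Unit) ℤ :=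
  Matrix.fromBlocks B 0 (Matrix.of fun _ c => D * (r ᵥ* B) c) (Matrix.of fun _ _ => D * q)

/-- `B'(x ∘ l₀) = Bx ∘ D(r·Bx + l₀q)` (Khot 2005, proof of Lemma 5.6, first display).
[cite: Khot2005, Lemma 5.6 (proof)] -/
theorem finBasis_mulVec (B : Matrix R C ℤ) (r : R → ℤ) (D q : ℤ) (x : C → ℤ) (l₀ : ℤ) :
    finBasis B r D q *ᵥ Sum.elim x (fun _ => l₀) =
      Sum.elim (B *ᵥ x) fun _ => D * (r ⬝ᵥ (B *ᵥ x) + l₀ * q) := by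
  rw [finBasis, Matrix.fromBlocks_mulVec]
  simp only [Sum.elim_comp_inl, Sum.elim_comp_inr, Matrix.zero_mulVec, add_zero]
  have h1 : (Matrix.of fun (_ : Unit) c => D * (r ᵥ* B) c) *ᵥ x = fun _ => D * (r ⬝ᵥ (B *ᵥ x)) := by
    funext u
    show (D • (r ᵥ* B)) ⬝ᵥ x = D * (r ⬝ᵥ (B *ᵥ x))
    rw [smul_dotProduct, Matrix.dotProduct_mulVec, smul_eq_mul]
  have h2 : (Matrix.of fun (_ : Unit) (_ : Unit) => D * q) *ᵥ (fun _ => l₀) = fun _ => D * q * l₀ := by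
    funext u
    simp [Matrix.mulVec, dotProduct]
  rw [h1, h2]
  congr 1
  funext u
  simp only [Pi.add_apply]
  ring

/-- **Lemma 5.6 (NO case), deterministic core.** Suppose the columns of `B` are independent,
`q ≠ 0`, and the row vector `r` KILLS every annoying lattice vector: `r·(Bx) ≢ 0 (mod q)`
whenever `Bx` is annoying (the printed lemma shows this happens with probability `≥ 99/100`
over `r`, by a union bound over the `≤ #A < q/100` annoying vectors). Then the final lattice
has the NO-structure of Thm. 5.1 (3) (`NoStructure`, the input of Lemma 7.2): for a nonzero
`x ∘ l₀`, either the last coordinate `D(rBx + l₀q)` is a nonzero multiple of `D`, or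
`rBx ≡ 0 (mod q)` and `Bx` is a nonzero non-annoying vector. [cite: Khot2005, Lemma 5.6] -/
theorem noStructure_finBasis {B : Matrix R C ℤ} (hB : ∀ x, B *ᵥ x = 0 → x = 0) {r : R → ℤ}
    {q : ℤ} (hq : q ≠ 0) {d D : ℕ}
    (hkill : ∀ x : C → ℤ, Annoying (B *ᵥ x) d D → ¬((q : ℤ) ∣ r ⬝ᵥ (B *ᵥ x))) :
    NoStructure (finBasis B r D q) d D := by
  intro x' hx'
  -- split the coefficient vector as `x ∘ l₀`
  have hx'eq : x' = Sum.elim (x' ∘ Sum.inl) (fun _ => x' (Sum.inr ())) := by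
    funext i; rcases i with i | ⟨⟩ <;> rfl
  set x : C → ℤ := x' ∘ Sum.inl
  set l₀ : ℤ := x' (Sum.inr ())
  rw [hx'eq, finBasis_mulVec]
  by_cases hlast : r ⬝ᵥ (B *ᵥ x) + l₀ * q = 0
  · -- the last coordinate vanishes: `Bx ≠ 0` is not annoying
    have hx : x ≠ 0 := by
      intro hx
      apply hx'
      rw [hx'eq]
      have hl : l₀ = 0 := by
        rw [hx, Matrix.mulVec_zero, dotProduct_zero, zero_add, mul_eq_zero] at hlast
        exact hlast.resolve_right hq
      rw [hx, hl]
      funext i; rcases i with i | ⟨⟩ <;> rfl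
    have hBx : B *ᵥ x ≠ 0 := fun h0 => hx (hB x h0)
    have hnotA : ¬Annoying (B *ᵥ x) d D := fun hA =>
      hkill x hA ⟨-l₀, by linarith⟩
    have hv : (Sum.elim (B *ᵥ x) fun _ : Unit => (D : ℤ) * (r ⬝ᵥ (B *ᵥ x) + l₀ * q)) =
        Sum.elim (B *ᵥ x) (0 : Unit → ℤ) := by
      rw [hlast, mul_zero]; rfl
    rw [hv]
    rcases alternatives_of_not_annoying hBx hnotA with ⟨i, hi⟩ | hd | ⟨heven, hd⟩
    · exact Or.inl ⟨Sum.inl i, hi⟩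
    · exact Or.inr (Or.inl (by rwa [hammingNorm_sum_elim_zero]))
    · refine Or.inr (Or.inr ⟨fun i => ?_, by rwa [hammingNorm_sum_elim_zero]⟩)
      rcases i with i | ⟨⟩
      · exact heven i
      · exact ⟨0, rfl⟩
  · -- the last coordinate is a nonzero multiple of `D`
    refine Or.inl ⟨Sum.inr (), ?_⟩
    simp only [Sum.elim_inr, abs_mul, Nat.abs_cast]
    exact le_mul_of_one_le_right (Nat.cast_nonneg D) (Int.one_le_abs hlast)

/-- **Lemma 5.7 (YES case), deterministic core.** Suppose `Bx*` is a good vector — nonzero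
coefficient vector `x*` with `‖x*‖² ≤ s₀`, `Bx*` a `{0,1,2}`-vector with `‖Bx*‖² ≤ g` — that
SURVIVES the random constraint: `r·(Bx*) ≡ 0 (mod q)`, for a row vector `r` with entries in
`[0, q)` (the printed lemma shows such a survivor exists with probability `≥ 99/100`, by
Lemma 5.8). Then "`r(B_int x*) = l₀q` for some `|l₀| ≤ γd`" (here `0 ≤ l₀ ≤ g`) and
`x' = x* ∘ (-l₀)` is a nonzero coefficient vector of the final lattice with `B'x' = Bx* ∘ 0`, so
`‖B'x'‖² ≤ g` and `‖x'‖² ≤ s₀ + g²` — the YES data consumed by Lemma 7.1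
(`Khot.short_vector_of_yes`). [cite: Khot2005, Lemma 5.7] -/
theorem yes_finBasis (B : Matrix R C ℤ) {r : R → ℤ} {q : ℤ} (hq : 0 < q)
    (hr : ∀ i, 0 ≤ r i ∧ r i < q) (D : ℤ) {x : C → ℤ} (hx : x ≠ 0)
    (h012 : ∀ i, (B *ᵥ x) i = 0 ∨ (B *ᵥ x) i = 1 ∨ (B *ᵥ x) i = 2)
    (hdiv : q ∣ r ⬝ᵥ (B *ᵥ x)) {g s₀ : ℤ} (hg : intSqNorm (B *ᵥ x) ≤ g) (hs : intSqNorm x ≤ s₀) :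
    ∃ l₀ : ℤ, 0 ≤ l₀ ∧ l₀ ≤ g ∧
      finBasis B r D q *ᵥ Sum.elim x (fun _ => -l₀) = Sum.elim (B *ᵥ x) 0 ∧
      Sum.elim x (fun _ : Unit => -l₀) ≠ 0 ∧
      intSqNorm (finBasis B r D q *ᵥ Sum.elim x (fun _ => -l₀)) ≤ g ∧
      intSqNorm (Sum.elim x (fun _ : Unit => -l₀)) ≤ s₀ + g ^ 2 := by
  obtain ⟨l₀, hl₀⟩ := hdiv
  set v := B *ᵥ x with hvdef
  -- `0 ≤ r·v ≤ (q-1)·‖v‖²`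
  have hvi : ∀ i, 0 ≤ v i ∧ v i ≤ v i ^ 2 := fun i => by
    rcases h012 i with h | h | h <;> rw [h] <;> norm_num
  have hlow : 0 ≤ r ⬝ᵥ v := Finset.sum_nonneg fun i _ => mul_nonneg (hr i).1 (hvi i).1
  have hup : r ⬝ᵥ v ≤ (q - 1) * intSqNorm v := by
    unfold intSqNorm
    rw [Finset.mul_sum]
    exact Finset.sum_le_sum fun i _ => by
      have h1 : r i ≤ q - 1 := by have := (hr i).2; omega
      calc r i * v i ≤ (q - 1) * v i := mul_le_mul_of_nonneg_right h1 (hvi i).1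
        _ ≤ (q - 1) * v i ^ 2 := mul_le_mul_of_nonneg_left (hvi i).2 (by omega)
  have hg0 : 0 ≤ intSqNorm v := intSqNorm_nonneg v
  have hl₀0 : 0 ≤ l₀ := by
    by_contra hneg
    push Not at hneg
    have : r ⬝ᵥ v ≤ -q := by rw [hl₀]; nlinarith
    linarith
  have hl₀g : l₀ ≤ g := by
    by_contra hgt
    push Not at hgt
    -- `q * l₀ ≤ (q-1) g' ` with `g' ≤ g < l₀` forces a contradiction
    have h1 : q * l₀ ≤ (q - 1) * intSqNorm v := hl₀ ▸ hup
    nlinarith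
  refine ⟨l₀, hl₀0, hl₀g, ?_, ?_, ?_, ?_⟩
  · rw [finBasis_mulVec, ← hvdef, hl₀]
    congr 1
    funext u
    simp only [Pi.zero_apply]
    ring
  · intro h0
    apply hx
    funext i
    exact congrFun h0 (Sum.inl i)
  · rw [finBasis_mulVec, ← hvdef, hl₀, intSqNorm_sum_elim]
    have : (fun _ : Unit => D * (q * l₀ + -l₀ * q)) = 0 := by funext u; simp only [Pi.zero_apply]; ring
    rw [this]
    simpa [intSqNorm] using hg
  · rw [intSqNorm_sum_elim]
    have : intSqNorm (fun _ : Unit => -l₀) = l₀ ^ 2 := by simp [intSqNorm]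
    rw [this]
    have : l₀ ^ 2 ≤ g ^ 2 := pow_le_pow_left₀ hl₀0 hl₀g 2
    linarith

end Final

end Khot

end Literature.Algebra.EuclideanLattices
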